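import Literature.NumberTheory.Sieve.BombieriAsymptoticSieveShiftedPrimes
import Literature.NumberTheory.Sieve.BombieriAsymptoticSieveProofs
import Literature.NumberTheory.Sieve.BombieriAsymptoticSieveSigma0
import HarnessLib

/-!
# `Literature.NumberTheory.Sieve.bombieri_asymptotic_sieve_shiftedPrimes`, proved

Topic `Literature/NumberTheory/Sieve`, companion ("Proofs") file of
`BombieriAsymptoticSieveShiftedPrimes.lean`. It DISCHARGES the named fact
`Literature.NumberTheory.Sieve.bombieri_asymptotic_sieve_shiftedPrimes` (`ParityBarrier.lean`, parity.S32 (ii): under the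
Elliott–Halberstam conjecture, `∑_{n ≤ x} Λ_k(n) Λ(n + 2) ∼ k H x (log x)^{k−1}` for every `k ≥ 2`,
`H = ∏_p (1 − g(p))(1 − 1/p)⁻¹` the density constant of the shifted primes):

`bombieri_asymptotic_sieve_shiftedPrimes_holds` is the composition of

* `bombieri_asymptotic_sieve_shiftedPrimes_of_asymptoticSieve`
  (`BombieriAsymptoticSieveShiftedPrimes.lean`: under EH the sequence `a_n = Λ(n+2)` satisfies
  Bombieri's hypotheses (A₁)–(A₅) with `θ₀ = 1`, [FriedlanderIwaniecPisa1978] p. 720 Example 1, and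
  `A(x) ∼ x`), with
* Bombieri's Theorem 1 in the `Λ_k`-form, `Bombieri1976_asymptotic_sieve`
  ([FriedlanderIwaniecPisa1978] p. 722 Theorem 1 = [BombieriRIMS1977] Theorem p. 5), which is now a
  theorem of the tree: `Bombieri1976_asymptotic_sieve_of_lemma10`
  (`BombieriAsymptoticSieveProofs.lean`: Lemmata 3, 5 (fundamental lemma), 6–9, 11, 12 and the
  conclusion pp. 739–740 proved) applied to `FI1978_lemma10_holds`
  (`BombieriAsymptoticSieveSigma0.lean`: Lemma 10, the `Σ₀`-bound).

So the whole of [FriedlanderIwaniecPisa1978] Theorem 1 (scalar case `k ≥ 2`, `θ₀ = 1`, `K = ℚ`)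
and its application to the shifted primes under EH are formalised without named facts beyond the
Elliott–Halberstam hypothesis carried by the statement itself.
-/

namespace Literature.NumberTheory.Sieve

/-- **Bombieri's Theorem 1 (scalar `Λ_k`-form, `k ≥ 2`) is a theorem of the tree**: the named
fact `Bombieri1976_asymptotic_sieve` ([FriedlanderIwaniecPisa1978] p. 722 Theorem 1 (Bombieri);
[BombieriRIMS1977] Theorem, p. 5) follows from `Bombieri1976_asymptotic_sieve_of_lemma10` and the
proof of Lemma 10, `FI1978_lemma10_holds`. (Recorded here under a local name; the canonical
discharge `Bombieri1976_asymptotic_sieve_holds` belongs with `BombieriAsymptoticSieve.lean`.)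
[cite: FriedlanderIwaniecPisa1978, Theorem 1] [cite: BombieriRIMS1977, Theorem (p. 5)] -/
theorem bombieri1976_asymptotic_sieve_proved : Bombieri1976_asymptotic_sieve :=
  Bombieri1976_asymptotic_sieve_of_lemma10 FI1978_lemma10_holds

/-- **Discharge of `Literature.NumberTheory.Sieve.bombieri_asymptotic_sieve_shiftedPrimes`** (parity.S32 (ii);
[FriedlanderIwaniecPisa1978] p. 720 Example 1 + p. 722 Theorem 1; [BombieriRIMS1977] p. 7: "put
`Λ(m+2) = a_m`"): under the Elliott–Halberstam conjecture, for every `k ≥ 2` and every `H` with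
`(shiftedPrimes 2).HasDensityConstant H`,
`∑_{n ≤ x} Λ_k(n) Λ(n + 2) ∼ k H x (log x)^{k−1}`.
[cite: FriedlanderIwaniecPisa1978, p. 720 Example 1 and p. 722 Theorem 1] [cite: BombieriRIMS1977, p. 7] -/
theorem bombieri_asymptotic_sieve_shiftedPrimes_holds : bombieri_asymptotic_sieve_shiftedPrimes :=
  bombieri_asymptotic_sieve_shiftedPrimes_of_asymptoticSieve bombieri1976_asymptotic_sieve_proved

end Literature.NumberTheory.Sieve
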